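import Summits.ResolutionOfSingularities.ResolutionOfSingularities.Theorems.WeightedInvariantELadderOneBaseDim
import Summits.ResolutionOfSingularities.ResolutionOfSingularities.Theorems.WeightedInvariantELadderTwoStage
import HarnessLib

/-!
# e-ladder, rung `e = 2`: the START stage (`E2Base`) — the dimension-free start stage and its dimension datum (I0)₂

Route `ResolutionOfSingularities/WeightedInvariant`, door crux `HypersurfaceCentreConstruction` (stmt-ResolutionOfSingularities-19897),
E-ladder rung `e = 2` (skeleton v3.9 `stub_e2_consumer`, split targets of `…ELadderTwoStage`); ORDER (o55) of res-L1-w43-plan-1 to res-type-056.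
[OURS · L1 W4.3; nothing here is a statement of H. Hironaka's manuscript or a claim about resolution in positive characteristic.]

* `exists_start_stage` — DIMENSION-FREE refactoring of `ELadderOne.stub_e1_base` (p508242): EVERY integral hypersurface pair `P` is the pair
  of a stage of torus rank `j = 0` (ambient `P.Y`, the hypersurface presented by its subscheme inclusion, `V = X`, `q = 𝟙`, the initial graded
  atlas of `DatumToEmbedded.InitialAtlas.stub_initialAtlas`); no invariant is claimed;
* `e2_base` — `E2Base p`: for a pair whose hypersurface is a SURFACE (`dim V(X) = 2`) that start stage satisfies (I0)₂ `dim X = j + 2`, read off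
  the pair by `Stage.topologicalKrullDim_X_eq_subscheme_toPair` exactly as `stub_e1_base_dim` does for rung `e = 1`.
-/

noncomputable section

set_option linter.dupNamespace false -- mandated namespace of this single-conjunct summit

open CategoryTheory AlgebraicGeometry TopologicalSpace IsLocalRing
open Literature.AlgebraicGeometry.Resolution
open Summit.ResolutionOfSingularities.ResolutionOfSingularities.Theorems
open Summit.ResolutionOfSingularities.ResolutionOfSingularities.Cruxes.HypersurfaceCentreConstruction.LocalEngine

namespace Summit.ResolutionOfSingularities.ResolutionOfSingularities.Theorems.ELadderOne

variable {k : Type} [Field k]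

/-- **THE START STAGE, DIMENSION-FREE.**  Every hypersurface pair is the underlying pair of a stage of torus rank `0`: present `P.X` by its
subscheme inclusion (`ker_subschemeι`), take `V = X`, `q = 𝟙`, and the initial rank-`0` graded atlas
(`DatumToEmbedded.InitialAtlas.stub_initialAtlas`).  (The construction of `stub_e1_base`, without its curve hypothesis and without any
invariant.) [folklore] -/
theorem exists_start_stage (P : HypersurfacePair k) : ∃ S : Stage k, S.j = 0 ∧ S.toPair = P := by
  haveI := P.isIntegral
  obtain ⟨𝒜⟩ := DatumToEmbedded.InitialAtlas.stub_initialAtlas P.f P.X.subschemeι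
  let S : Stage k :=
    { Y := P.Y, f := P.f, X := P.X.subscheme, i := P.X.subschemeι
      isLocallyPrincipal := by rw [Scheme.IdealSheafData.ker_subschemeι]; exact P.isLocallyPrincipal
      V := P.X.subscheme, q := 𝟙 _, g := P.X.subschemeι ≫ P.f, hq := Category.id_comp _, j := 0, atlas := 𝒜 }
  refine ⟨S, rfl, ?_⟩
  obtain ⟨Y, f, X, hlp, hint⟩ := P
  simp only [S, Stage.toPair, HypersurfacePair.ofKer]
  congr 1
  exact Scheme.IdealSheafData.ker_subschemeι X

/-- **`E2Base` HOLDS** (the split target of `stub_e2_consumer` for the start): an integral hypersurface pair of dimension `2` over a perfect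
field of characteristic `p` is the pair of a start stage (`j = 0`) with (I0)₂ `dim X = j + 2`. [folklore] -/
theorem e2_base (p : ℕ) : E2Base p := by
  intro k _ _ _ P hP
  obtain ⟨S, hj, hSP⟩ := exists_start_stage P
  refine ⟨S, ?_, hj, hSP⟩
  show topologicalKrullDim S.X = ((S.j + 2 : ℕ) : WithBot ℕ∞)
  rw [S.topologicalKrullDim_X_eq_subscheme_toPair, hSP, hP, hj]

end Summit.ResolutionOfSingularities.ResolutionOfSingularities.Theorems.ELadderOne

end
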